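/-
Copyright (c) 2026 the pub-hodgecm-mathlib formalisation cell (harness21).  Prover seat hodgecm-mathlib-LH5-p04 (g11), 2026-09-03.  E1 BRICK LEDGER row 56-B3(55-B-3b) «TAME TWIN
OF THE 55-B IWAHORI ∕ EDGE PACKAGE», FILE 4-RAM (E1 keeper ∕ dealer F0P3a-p03 (g30) «= YOURS» 04:45:49Z; LEAD F0P3a-plan T15-42 (iii); FILES 1–3-RAM = F0P3a-p06 (g26)).
-/
import Summits.HodgeConjecture.HodgeConjecture.Theorems.F0P3cStCharTSBorelDoubleCosetsIwahoriAtDatum    -- ★ B-3b p853570 («LH10» LH10-p02 g14): the PLACE-FREE `mapEdgeSet_actionHom_inv_eq ∕ _one`; brings ★ B-3a (`actionHom_*`, `mapEdgeSet_actionHom_mul`, `actionHom_zpow_apartmentEnum`, `isCompact_subgroupOf_M_inf`) and ★ B-1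
import Summits.HodgeConjecture.HodgeConjecture.Theorems.F0P3cStCharTSBorelDoubleCosetsAtDatumRamified   -- FILE 3-RAM (F0P3a-p06 g26): `exists_mem_N_forall_apartmentEnum_eq_of_mem_P_of_involution`, `exists_torus_mul_unipotent_of_mem_P_of_apply_apartmentEnum_of_neg`; brings FILE 1-RAM (`exists_horocycleIndex_vertices∕edges_of_neg`, `apartmentEnum_eq_self_…_of_involution`), ★ B1 (`apartmentEnum_injective_of_involution`, `latticeGraph_adj_apartmentEnum_succ_of_involution`), ★ (O), ★ (T-I)∕(T-II)
import HarnessLib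

/-!
# Row 56-B3(55-B), FILE 4 — THE TAME TWIN of ★ 55-B-3b «BOREL DOUBLE COSETS THROUGH THE IWAHORI»: `Γ = B · Stab(e₀) ⊔ B · (τ w₀) · Stab(e₀)` and
# `B ∩ Stab(e) = (T ∩ Stab(A 0)) · (N ∩ Stab(e))` on the `U(Φ₃)(L⁺_v)` tree at a TAMELY RAMIFIED place (`σ_w ϖ = −ϖ`, `|2|_w = 1`) — Bruhat–Tits 1972 (4.4.3)–(4.4.4), §10

Cell `pub/hodgecm-mathlib` (D-0151), crux H413 = `stmt-HodgeConjecture-24833`; lane `--kind proof --supports stmt-HodgeConjecture-24833 --as helper` (THEOREMS ONLY: no definition ∕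
instance ∕ notation ∕ named fact ∕ `sorry`; count-neutral: closes no node).  Namespace `Summit.HodgeConjecture.HodgeConjecture.Cruxes.H413.F0P3cStCharTSHorocyclesAtDatumRamified` (= FILE
1-RAM's, as ★ B-3b shares ★ B-1's).  Sibling of ★ `F0P3cStCharTSBorelDoubleCosetsIwahoriAtDatum` (row 55-B-3b, «LH10» LH10-p02 (g14)).  CENSUS (this seat, 04:46Z): ★ B-3b reads the
unramified datum `hd` ONLY inside the apartment-edge certificates `latticeGraph_adj_apartmentEnum_succ hd A hA0 hA1 _` (proof-irrelevant; here ★ B1's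
`latticeGraph_adj_apartmentEnum_succ_of_involution hσ hvσ hϖ A hA0 hA1 _`) and through its ★ callees — ★ B-1 `exists_horocycleIndex_edges∕_vertices` and
`apartmentEnum_eq_self_of_mem_cmBorelTriple_M_of_apply_zero`, ★ B-3a `exists_mem_N_forall_apartmentEnum_eq_of_mem_P` and `exists_torus_mul_unipotent_of_mem_P_of_apply_apartmentEnum`,
★ 39γ `apartmentEnum_injective` — whose tame siblings are FILE 1-RAM ∕ FILE 3-RAM (F0P3a-p06 (g26)) and ★ B1 (LH5-p04 (g10)).  So its five `hd`-binding heads are re-issued with `hd`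
replaced POSITIONALLY by place letters printed EXPLICITLY after the section block (F0P3a-p06's v2 convention, forced by the gate's textual `dedup.landed`):
`mapEdgeSet_apartmentEnum_eq_self_of_forall_apply_eq_of_involution` and `mapEdgeSet_tau_weylLong_apartmentEnum_zero_of_involution` with `(hσ hvσ hϖ)` (ANY isometric involution —
only the certificates change), and `mapEdgeSet_apartmentEnum_zero_ne_one_of_mem_P_of_neg`, `exists_torus_mul_unipotent_of_mem_P_of_mapEdgeSet_eq_of_neg` and the PACKAGE
`borelDoubleCoset_edge_of_neg` with `(hσ hvσ hϖ hσϖ hres h2 hnorm)` (the seven TAME letters of ★ `isTree_latticeGraph_three_of_neg`, IN ORDER); every other binder (`(w hw) {ϖ}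
(eA heA) {a} (ha) (A hA0 hA1) (t ht τM hτM hτA)`, `P₀ P₁ hP₀ hP₁ …`), every budget and every conclusion VERBATIM = ★ B-3b's; proofs = ★ B-3b's with the six callees swapped;
★ B-3b's two place-free heads `mapEdgeSet_actionHom_inv_eq ∕ mapEdgeSet_actionHom_one` and ★ B-3a's `isCompact_subgroupOf_M_inf` are used BY NAME (no restatement).  Consumer:
the NOT-WILD widening of row 61's (α)-package supplier at the Iwahori ∕ edge type ((X3)(X4), `ι := Fin 2`, `g := ![1, τM · w₀]`).
HONEST LABEL: count-neutral datum helper; TAME road GO-LOW (LEAD T15-42); WILD (dyadic) places stay PRINT (`h2 : |2| = 1` is a binder); E1 = PRINT until the keeper's charter test;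
h413 OPEN; HC_CM is proved only modulo the 7 printed citations (2 remaining named inputs hLiu418 = stmt-HodgeConjecture-24832, h413 = stmt-HodgeConjecture-24833) until rung 0 closes;
nothing printed is asserted here.

## References
* [BruhatTits1972] F. Bruhat, J. Tits, *Groupes réductifs sur un corps local I*, Publ. Math. IHÉS 41 (1972), (4.4.3) (Iwasawa), (4.4.4), §10.
* [Tits1979] J. Tits, *Reductive groups over local fields*, Proc. Sympos. Pure Math. 33.1 (1979), §2.4 (the ramified quasi-split `SU₃`), §3.3.3.
* [Rogawski1990] J. D. Rogawski, *Automorphic Representations of Unitary Groups in Three Variables*, Ann. of Math. Stud. 123 (1990), §1.10 p. 9, §4.5 p. 45.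
* [Serre1980Trees] J.-P. Serre, *Trees* (1980), Ch. II §1.1, Ch. I §6.4.
* [SchneiderStuhler1997] P. Schneider, U. Stuhler, *Representation theory and sheaves on the Bruhat–Tits building*, Publ. Math. IHÉS 85 (1997), §III.4 (Lemma III.4.13).
-/

set_option autoImplicit false
-- the mandated namespace has the single-problem summit's repeated segment (`HodgeConjecture.HodgeConjecture`)
set_option linter.dupNamespace false

noncomputable section

open NumberField IsDedekindDomain
open scoped Valued WithZero Matrix MatrixGroups
open Literature.NumberTheory.Rogawski1990 Literature.NumberTheory.Automorphic Literature.NumberTheory.Automorphic.UnitaryGroup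
open Literature.NumberTheory.Automorphic.UnitaryLatticeTree Literature.NumberTheory.Automorphic.HermitianLattice

namespace Summit.HodgeConjecture.HodgeConjecture.Cruxes.H413.F0P3cStCharTSHorocyclesAtDatumRamified

open Summit.HodgeConjecture.HodgeConjecture.Cruxes.H413.F0P3cStCharTSHorocyclesAtDatum

/-! ## §5.2-RAM THE IWAHORI ∕ EDGE TYPE at a tame ramified place: `Γ = B · Stab(e₀) ⊔ B · (τ w₀) · Stab(e₀)`, `B ∩ Stab(e) = (T ∩ Stab(A 0)) · (N ∩ Stab(e))` -/

section Iwahori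

variable (L : Type) [Field L] [NumberField L] [IsCMField L] (v : HeightOneSpectrum (𝓞 ↥(maximalRealSubfield L)))
  (w : PlacesOver L v) (hw : IsCMField.complexConj L • w.1 = w.1) {ϖ : w.1.adicCompletion L}
  (eA : Gqs L v ≃ₜ* ↥(unitaryGroupOfForm (galAdicCompletionMap (L := L) (IsCMField.complexConj L) hw) ((StdForm.antidiagonal 3).over (w.1.adicCompletion L))))
  (heA : ∀ g : Gqs L v,
    ((eA g : ↥(unitaryGroupOfForm (galAdicCompletionMap (L := L) (IsCMField.complexConj L) hw) ((StdForm.antidiagonal 3).over (w.1.adicCompletion L)))) :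
        GL (Fin 3) (w.1.adicCompletion L)) =
      ((localNonsplitEquiv (IsCMField.complexConj L) (qsForm L) (IsCMField.complexConj_ne_one L) w hw g :
        ↥(unitaryGroupOfForm (galAdicCompletionMap (L := L) (IsCMField.complexConj L) hw) (placeForm (qsForm L) w.1))) : GL (Fin 3) (w.1.adicCompletion L)))
  {a : Gqs L v →* ((latticeGraph (galAdicCompletionMap (L := L) (IsCMField.complexConj L) hw) ϖ ((StdForm.antidiagonal 3).over (w.1.adicCompletion L))) ≃g
    (latticeGraph (galAdicCompletionMap (L := L) (IsCMField.complexConj L) hw) ϖ ((StdForm.antidiagonal 3).over (w.1.adicCompletion L))))}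
  (ha : ∀ g, a g = latticeGraphIso (galAdicCompletionMap (L := L) (IsCMField.complexConj L) hw) ϖ ((StdForm.antidiagonal 3).over (w.1.adicCompletion L)) (eA g))
  (A : ℤ → {M : Submodule 𝒪[(w.1.adicCompletion L)] (Fin 3 → (w.1.adicCompletion L)) //
    IsVertex (galAdicCompletionMap (L := L) (IsCMField.complexConj L) hw) ϖ ((StdForm.antidiagonal 3).over (w.1.adicCompletion L)) M})
  (hA0 : ∀ c : ℤ, (A (2 * c)).1 = latt (Matrix.diagonal ![ϖ ^ c, (1 : w.1.adicCompletion L), ϖ ^ (-c)]))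
  (hA1 : ∀ c : ℤ, (A (2 * c + 1)).1 = latt (Matrix.diagonal ![ϖ ^ (c + 1), (1 : w.1.adicCompletion L), ϖ ^ (-c)]))
  (t : ParabolicTriple (Gqs L v)) (ht : t = cmBorelTriple L 3 v)
  (τM : Gqs L v) (hτM : τM ∈ t.M) (hτA : ∀ j : ℤ, a τM (A j) = A (j + 2))

include hA0 hA1 in
/-- An element fixing every apartment vertex fixes every apartment edge — ANY isometric involution (twin of ★ `mapEdgeSet_apartmentEnum_eq_self_of_forall_apply_eq`: `hd` sat only in the edge
certificate, here ★ B1's `latticeGraph_adj_apartmentEnum_succ_of_involution`; conclusion VERBATIM up to that proof-irrelevant certificate). [cite: Serre1980Trees, II.1.1] -/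
theorem mapEdgeSet_apartmentEnum_eq_self_of_forall_apply_eq_of_involution
    (hσ : ∀ x, (galAdicCompletionMap (L := L) (IsCMField.complexConj L) hw) ((galAdicCompletionMap (L := L) (IsCMField.complexConj L) hw) x) = x)
    (hvσ : ∀ x, Valued.v ((galAdicCompletionMap (L := L) (IsCMField.complexConj L) hw) x) = Valued.v x) (hϖ : Valued.v ϖ = WithZero.exp (-1 : ℤ))
    {c : Gqs L v} (hc : ∀ k : ℤ, a c (A k) = A k) (j : ℤ) :
    (a c).mapEdgeSet ⟨s(A j, A (j + 1)), (SimpleGraph.mem_edgeSet _).2 (latticeGraph_adj_apartmentEnum_succ_of_involution hσ hvσ hϖ A hA0 hA1 j)⟩ =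
      ⟨s(A j, A (j + 1)), (SimpleGraph.mem_edgeSet _).2 (latticeGraph_adj_apartmentEnum_succ_of_involution hσ hvσ hϖ A hA0 hA1 j)⟩ := by
  apply Subtype.ext
  change Sym2.map (a c) s(A j, A (j + 1)) = s(A j, A (j + 1))
  rw [Sym2.map_mk, hc, hc]

include ha hA0 hA1 hτA in
set_option maxHeartbeats 800000 in  -- `Subtype.ext` ∕ `Sym2` on the datum edge type (isDefEq on the CM carriers)
/-- **THE REFLECTED EDGE, ANY ISOMETRIC INVOLUTION** (twin of ★ `mapEdgeSet_tau_weylLong_apartmentEnum_zero`, `hd ↦ (hσ hvσ hϖ)` in the certificates only; conclusion VERBATIM): `(τM · w₀) · {A 0, A 1} = {A 1, A 2}` (`w₀ · A j = A (−j)` ★ A-III, then `τM`). [cite: BruhatTits1972, §10] [cite: Serre1980Trees, II.1.1] -/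
theorem mapEdgeSet_tau_weylLong_apartmentEnum_zero_of_involution
    (hσ : ∀ x, (galAdicCompletionMap (L := L) (IsCMField.complexConj L) hw) ((galAdicCompletionMap (L := L) (IsCMField.complexConj L) hw) x) = x)
    (hvσ : ∀ x, Valued.v ((galAdicCompletionMap (L := L) (IsCMField.complexConj L) hw) x) = Valued.v x) (hϖ : Valued.v ϖ = WithZero.exp (-1 : ℤ)) :
    (a (τM * eA.symm (weylLongU (galAdicCompletionMap (L := L) (IsCMField.complexConj L) hw)
        (rfl : (StdForm.antidiagonal 3).over (w.1.adicCompletion L) = (StdForm.antidiagonal 3).over (w.1.adicCompletion L))))).mapEdgeSet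
        ⟨s(A 0, A (0 + 1)), (SimpleGraph.mem_edgeSet _).2 (latticeGraph_adj_apartmentEnum_succ_of_involution hσ hvσ hϖ A hA0 hA1 0)⟩ =
      ⟨s(A 1, A (1 + 1)), (SimpleGraph.mem_edgeSet _).2 (latticeGraph_adj_apartmentEnum_succ_of_involution hσ hvσ hϖ A hA0 hA1 1)⟩ := by
  apply Subtype.ext
  change Sym2.map (a (τM * eA.symm (weylLongU (galAdicCompletionMap (L := L) (IsCMField.complexConj L) hw) rfl))) s(A 0, A (0 + 1)) = s(A 1, A (1 + 1))
  rw [Sym2.map_mk, actionHom_mul_apply L v w hw eA ha, actionHom_mul_apply L v w hw eA ha, ha (eA.symm _), ContinuousMulEquiv.apply_symm_apply,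
    latticeGraphIso_weylLongU_apartmentEnum A hA0 hA1, latticeGraphIso_weylLongU_apartmentEnum A hA0 hA1, hτA, hτA, Sym2.eq_swap]
  congr 1

include heA ha hA0 hA1 ht in
set_option maxHeartbeats 1600000 in  -- the datum vertex∕edge types (41g-H ∕ 48-datum `whnf` wall)
/-- **A BOREL ELEMENT MOVES THE BASE EDGE TO AN EDGE OF EVEN HOROCYCLE INDEX, at a tame ramified place** (`hd ↦ hσ hvσ hϖ hσϖ hres h2 hnorm` POSITIONAL; twin of ★
`mapEdgeSet_apartmentEnum_zero_ne_one_of_mem_P` over FILE 1-RAM `exists_horocycleIndex_edges_of_neg` + FILE 3-RAM `exists_mem_N_forall_apartmentEnum_eq_of_mem_P_of_involution`; conclusion VERBATIM): for `b ∈ B(L⁺_v)`, `b · {A 0, A 1} = n · {A (2c₀), A (2c₀+1)}` with `n ∈ N(L⁺_v)`; in particular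
`b · {A 0, A 1} ≠ {A 1, A 2}` (horocycle index `1`).  The `hdisj` letter of the Iwahori package. [cite: BruhatTits1972, §10] [cite: Serre1980Trees, II.1.1] -/
theorem mapEdgeSet_apartmentEnum_zero_ne_one_of_mem_P_of_neg
    (hσ : ∀ x, (galAdicCompletionMap (L := L) (IsCMField.complexConj L) hw) ((galAdicCompletionMap (L := L) (IsCMField.complexConj L) hw) x) = x)
    (hvσ : ∀ x, Valued.v ((galAdicCompletionMap (L := L) (IsCMField.complexConj L) hw) x) = Valued.v x) (hϖ : Valued.v ϖ = WithZero.exp (-1 : ℤ))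
    (hσϖ : (galAdicCompletionMap (L := L) (IsCMField.complexConj L) hw) ϖ = -ϖ)
    (hres : ∀ x : (w.1.adicCompletion L), Valued.v x ≤ 1 → Valued.v ((galAdicCompletionMap (L := L) (IsCMField.complexConj L) hw) x - x) < 1)
    (h2 : Valued.v (2 : (w.1.adicCompletion L)) = 1)
    (hnorm : ∀ u : (w.1.adicCompletion L), (galAdicCompletionMap (L := L) (IsCMField.complexConj L) hw) u = u → Valued.v (u - 1) < 1 →
    ∃ z : (w.1.adicCompletion L), z * (galAdicCompletionMap (L := L) (IsCMField.complexConj L) hw) z = u ∧ Valued.v (z - 1) ≤ Valued.v (u - 1))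
    {b : Gqs L v} (hb : b ∈ t.P) :
    (a b).mapEdgeSet ⟨s(A 0, A (0 + 1)), (SimpleGraph.mem_edgeSet _).2 (latticeGraph_adj_apartmentEnum_succ_of_involution hσ hvσ hϖ A hA0 hA1 0)⟩ ≠
      ⟨s(A 1, A (1 + 1)), (SimpleGraph.mem_edgeSet _).2 (latticeGraph_adj_apartmentEnum_succ_of_involution hσ hvσ hϖ A hA0 hA1 1)⟩ := by
  obtain ⟨idx₁, tr₁, -, -, hidxN₁, hidxA₁⟩ := exists_horocycleIndex_edges_of_neg L v w hw eA heA ha A hA0 hA1 hσ hvσ hϖ hσϖ hres h2 hnorm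
  obtain ⟨n, hn, c₀, hbn⟩ := exists_mem_N_forall_apartmentEnum_eq_of_mem_P_of_involution L v w hw eA heA ha A hA0 hA1 t ht hσ hvσ hϖ hb
  have hn' : n ∈ (cmBorelTriple L 3 v : ParabolicTriple (Gqs L v)).N := by subst ht; exact hn
  intro h
  have key : (a n).mapEdgeSet ⟨s(A (0 + 2 * c₀), A (0 + 2 * c₀ + 1)), (SimpleGraph.mem_edgeSet _).2 (latticeGraph_adj_apartmentEnum_succ_of_involution hσ hvσ hϖ A hA0 hA1 (0 + 2 * c₀))⟩ =
      ⟨s(A 1, A (1 + 1)), (SimpleGraph.mem_edgeSet _).2 (latticeGraph_adj_apartmentEnum_succ_of_involution hσ hvσ hϖ A hA0 hA1 1)⟩ := by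
    rw [← h]
    apply Subtype.ext
    change Sym2.map (a n) s(A (0 + 2 * c₀), A (0 + 2 * c₀ + 1)) = Sym2.map (a b) s(A 0, A (0 + 1))
    rw [Sym2.map_mk, Sym2.map_mk, hbn, hbn, show (0 : ℤ) + 1 + 2 * c₀ = 0 + 2 * c₀ + 1 by ring]
  have h2 := congrArg idx₁ key
  rw [hidxN₁ n hn', hidxA₁, hidxA₁] at h2
  omega

include heA ha hA0 hA1 ht in
set_option maxHeartbeats 1600000 in  -- as above
/-- **`B ∩ Stab{A m, A (m+1)} = (T ∩ Stab(𝒜)) · (N ∩ Stab{A m, A (m+1)})` at a tame ramified place** (7 letters POSITIONAL; twin of ★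
`exists_torus_mul_unipotent_of_mem_P_of_mapEdgeSet_eq` over FILE 1-RAM `exists_horocycleIndex_vertices_of_neg`, FILE 3-RAM `…_of_involution ∕ …_of_neg`, ★ B1 `apartmentEnum_injective_of_involution`;
conclusion VERBATIM): a Borel element fixing an apartment EDGE setwise fixes both endpoints (no inversion: the horocycle index of
`b · A m` has the parity of `m`), hence (★ B-3a `exists_torus_mul_unipotent_of_mem_P_of_apply_apartmentEnum`) is `c · n` with `c ∈ T(L⁺_v)` fixing every apartment vertex and
`n ∈ N(L⁺_v)` fixing the edge. [cite: BruhatTits1972, §10] [cite: Rogawski1990, §1.10 p. 9] [cite: Serre1980Trees, II.1.1] -/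
theorem exists_torus_mul_unipotent_of_mem_P_of_mapEdgeSet_eq_of_neg
    (hσ : ∀ x, (galAdicCompletionMap (L := L) (IsCMField.complexConj L) hw) ((galAdicCompletionMap (L := L) (IsCMField.complexConj L) hw) x) = x)
    (hvσ : ∀ x, Valued.v ((galAdicCompletionMap (L := L) (IsCMField.complexConj L) hw) x) = Valued.v x) (hϖ : Valued.v ϖ = WithZero.exp (-1 : ℤ))
    (hσϖ : (galAdicCompletionMap (L := L) (IsCMField.complexConj L) hw) ϖ = -ϖ)
    (hres : ∀ x : (w.1.adicCompletion L), Valued.v x ≤ 1 → Valued.v ((galAdicCompletionMap (L := L) (IsCMField.complexConj L) hw) x - x) < 1)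
    (h2 : Valued.v (2 : (w.1.adicCompletion L)) = 1)
    (hnorm : ∀ u : (w.1.adicCompletion L), (galAdicCompletionMap (L := L) (IsCMField.complexConj L) hw) u = u → Valued.v (u - 1) < 1 →
    ∃ z : (w.1.adicCompletion L), z * (galAdicCompletionMap (L := L) (IsCMField.complexConj L) hw) z = u ∧ Valued.v (z - 1) ≤ Valued.v (u - 1))
    {b : Gqs L v} (hb : b ∈ t.P) {m : ℤ}
    (hbm : (a b).mapEdgeSet ⟨s(A m, A (m + 1)), (SimpleGraph.mem_edgeSet _).2 (latticeGraph_adj_apartmentEnum_succ_of_involution hσ hvσ hϖ A hA0 hA1 m)⟩ =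
      ⟨s(A m, A (m + 1)), (SimpleGraph.mem_edgeSet _).2 (latticeGraph_adj_apartmentEnum_succ_of_involution hσ hvσ hϖ A hA0 hA1 m)⟩) :
    ∃ c n : Gqs L v, c ∈ t.M ∧ (∀ k : ℤ, a c (A k) = A k) ∧ n ∈ t.N ∧
      (a n).mapEdgeSet ⟨s(A m, A (m + 1)), (SimpleGraph.mem_edgeSet _).2 (latticeGraph_adj_apartmentEnum_succ_of_involution hσ hvσ hϖ A hA0 hA1 m)⟩ =
        ⟨s(A m, A (m + 1)), (SimpleGraph.mem_edgeSet _).2 (latticeGraph_adj_apartmentEnum_succ_of_involution hσ hvσ hϖ A hA0 hA1 m)⟩ ∧ b = c * n := by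
  obtain ⟨idx, tr, -, -, hidxN, hidxA⟩ := exists_horocycleIndex_vertices_of_neg L v w hw eA heA ha A hA0 hA1 hσ hvσ hϖ hσϖ hres h2 hnorm
  have hval := congrArg Subtype.val hbm
  change Sym2.map (a b) s(A m, A (m + 1)) = s(A m, A (m + 1)) at hval
  rw [Sym2.map_mk, Sym2.eq_iff] at hval
  -- no inversion
  have hfix : a b (A m) = A m := by
    rcases hval with ⟨h1, -⟩ | ⟨h1, -⟩
    · exact h1
    · exfalso
      obtain ⟨n, hn, c₀, hbn⟩ := exists_mem_N_forall_apartmentEnum_eq_of_mem_P_of_involution L v w hw eA heA ha A hA0 hA1 t ht hσ hvσ hϖ hb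
      have hn' : n ∈ (cmBorelTriple L 3 v : ParabolicTriple (Gqs L v)).N := by subst ht; exact hn
      have h2 := congrArg idx ((hbn m).symm.trans h1)
      rw [hidxN n hn', hidxA, hidxA] at h2
      omega
  have hfix' : a b (A (m + 1)) = A (m + 1) := by
    rcases hval with ⟨-, h2⟩ | ⟨h1, -⟩
    · exact h2
    · exact absurd (h1.symm.trans hfix) fun h => by have := apartmentEnum_injective_of_involution hϖ A hA0 hA1 h; omega
  obtain ⟨c, n, hcM, hcA, hnN, hnA, hbcn⟩ := exists_torus_mul_unipotent_of_mem_P_of_apply_apartmentEnum_of_neg L v w hw eA heA ha A hA0 hA1 t ht hσ hvσ hϖ hσϖ hres h2 hnorm hb hfix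
  refine ⟨c, n, hcM, hcA, hnN, ?_, hbcn⟩
  have hn1 : a n (A (m + 1)) = A (m + 1) := by
    have : n = c⁻¹ * b := by rw [hbcn, inv_mul_cancel_left]
    rw [this, actionHom_mul_apply L v w hw eA ha, hfix']
    exact actionHom_inv_apply_eq L v w hw eA ha (hcA (m + 1))
  apply Subtype.ext
  change Sym2.map (a n) s(A m, A (m + 1)) = s(A m, A (m + 1))
  rw [Sym2.map_mk, hnA, hn1]

include heA ha hA0 hA1 ht hτM hτA in
set_option maxHeartbeats 3200000 in  -- the datum edge type through ★ (α)'s five binder shapes (statement `whnf` + `fin_cases` on the CM carriers)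
/-- **(X3∕X4) THE (α) PACKAGE AT THE IWAHORI ∕ EDGE TYPE, at a tame ramified place** (`hd ↦ hσ hvσ hϖ hσϖ hres h2 hnorm` POSITIONAL; twin of ★ `borelDoubleCoset_edge`, conclusion
VERBATIM = `hcover ∧ hdisj ∧ hT ∧ hdec ∧ hC`; ★ B-3a `isCompact_subgroupOf_M_inf` and ★ B-3b `mapEdgeSet_actionHom_inv_eq ∕ _one` BY NAME) (`ι := Fin 2`, `g := ![1, τM · w₀]`, `H := B = t.P`, `K := P₁ = Stab{A 0, A 1}`, `T i := B ⊓ (g i) P₁ (g i)⁻¹`,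
`C i := (T ∩ Stab(A 0)).subgroupOf (T i)`, `N i := t.N.subgroupOf (T i)`): the binders `hcover hdisj hT hdec hC` of ★ `Representation.finrank_intertwiningMap_smoothIndRep_eq_sum_finrank_eigen`
at the datum — TWO Borel double cosets through the Iwahori (= the two parities of the horocycle index of an edge).
[cite: BruhatTits1972, (4.4.3)–(4.4.4) and §10] [cite: Rogawski1990, §1.10 p. 9; §4.5 p. 45] [cite: SchneiderStuhler1997, §III.4] [cite: Serre1980Trees, II.1.1] -/
theorem borelDoubleCoset_edge_of_neg
    (hσ : ∀ x, (galAdicCompletionMap (L := L) (IsCMField.complexConj L) hw) ((galAdicCompletionMap (L := L) (IsCMField.complexConj L) hw) x) = x)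
    (hvσ : ∀ x, Valued.v ((galAdicCompletionMap (L := L) (IsCMField.complexConj L) hw) x) = Valued.v x) (hϖ : Valued.v ϖ = WithZero.exp (-1 : ℤ))
    (hσϖ : (galAdicCompletionMap (L := L) (IsCMField.complexConj L) hw) ϖ = -ϖ)
    (hres : ∀ x : (w.1.adicCompletion L), Valued.v x ≤ 1 → Valued.v ((galAdicCompletionMap (L := L) (IsCMField.complexConj L) hw) x - x) < 1)
    (h2 : Valued.v (2 : (w.1.adicCompletion L)) = 1)
    (hnorm : ∀ u : (w.1.adicCompletion L), (galAdicCompletionMap (L := L) (IsCMField.complexConj L) hw) u = u → Valued.v (u - 1) < 1 →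
    ∃ z : (w.1.adicCompletion L), z * (galAdicCompletionMap (L := L) (IsCMField.complexConj L) hw) z = u ∧ Valued.v (z - 1) ≤ Valued.v (u - 1))
    (P₀ P₁ : Subgroup (Gqs L v)) (hP₀ : ∀ g, g ∈ P₀ ↔ a g (A 0) = A 0)
    (hP₁ : ∀ g, g ∈ P₁ ↔ (a g).mapEdgeSet ⟨s(A 0, A (0 + 1)), (SimpleGraph.mem_edgeSet _).2 (latticeGraph_adj_apartmentEnum_succ_of_involution hσ hvσ hϖ A hA0 hA1 0)⟩ =
      ⟨s(A 0, A (0 + 1)), (SimpleGraph.mem_edgeSet _).2 (latticeGraph_adj_apartmentEnum_succ_of_involution hσ hvσ hϖ A hA0 hA1 0)⟩) :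
    (∀ y : Gqs L v, ∃ i : Fin 2, ∃ h : ↥t.P, ∃ κ ∈ P₁,
      y = (h : Gqs L v) * (![(1 : Gqs L v), τM * eA.symm (weylLongU (galAdicCompletionMap (L := L) (IsCMField.complexConj L) hw) rfl)] i) * κ) ∧
    (∀ i j : Fin 2, (∃ h : ↥t.P, ∃ κ ∈ P₁,
      (![(1 : Gqs L v), τM * eA.symm (weylLongU (galAdicCompletionMap (L := L) (IsCMField.complexConj L) hw) rfl)] j) =
        (h : Gqs L v) * (![(1 : Gqs L v), τM * eA.symm (weylLongU (galAdicCompletionMap (L := L) (IsCMField.complexConj L) hw) rfl)] i) * κ) → i = j) ∧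
    (∀ (i : Fin 2) (y : Gqs L v),
      y ∈ t.P ⊓ P₁.map (MulAut.conj (![(1 : Gqs L v), τM * eA.symm (weylLongU (galAdicCompletionMap (L := L) (IsCMField.complexConj L) hw) rfl)] i)).toMonoidHom ↔
        y ∈ t.P ∧ (![(1 : Gqs L v), τM * eA.symm (weylLongU (galAdicCompletionMap (L := L) (IsCMField.complexConj L) hw) rfl)] i)⁻¹ * y *
          (![(1 : Gqs L v), τM * eA.symm (weylLongU (galAdicCompletionMap (L := L) (IsCMField.complexConj L) hw) rfl)] i) ∈ P₁) ∧
    (∀ (i : Fin 2) (x : ↥(t.P ⊓ P₁.map (MulAut.conj (![(1 : Gqs L v), τM * eA.symm (weylLongU (galAdicCompletionMap (L := L) (IsCMField.complexConj L) hw) rfl)] i)).toMonoidHom)),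
      ∃ c ∈ (t.M ⊓ P₀).subgroupOf (t.P ⊓ P₁.map (MulAut.conj (![(1 : Gqs L v), τM * eA.symm (weylLongU (galAdicCompletionMap (L := L) (IsCMField.complexConj L) hw) rfl)] i)).toMonoidHom),
      ∃ n ∈ t.N.subgroupOf (t.P ⊓ P₁.map (MulAut.conj (![(1 : Gqs L v), τM * eA.symm (weylLongU (galAdicCompletionMap (L := L) (IsCMField.complexConj L) hw) rfl)] i)).toMonoidHom),
      x = c * n) ∧
    (∀ i : Fin 2, IsCompact (((t.M ⊓ P₀).subgroupOf
      (t.P ⊓ P₁.map (MulAut.conj (![(1 : Gqs L v), τM * eA.symm (weylLongU (galAdicCompletionMap (L := L) (IsCMField.complexConj L) hw) rfl)] i)).toMonoidHom) :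
        Subgroup ↥(t.P ⊓ P₁.map (MulAut.conj (![(1 : Gqs L v), τM * eA.symm (weylLongU (galAdicCompletionMap (L := L) (IsCMField.complexConj L) hw) rfl)] i)).toMonoidHom)) :
      Set ↥(t.P ⊓ P₁.map (MulAut.conj (![(1 : Gqs L v), τM * eA.symm (weylLongU (galAdicCompletionMap (L := L) (IsCMField.complexConj L) hw) rfl)] i)).toMonoidHom))) := by
  set W : Gqs L v := τM * eA.symm (weylLongU (galAdicCompletionMap (L := L) (IsCMField.complexConj L) hw) rfl) with hW
  obtain ⟨idx₁, tr₁, htrN₁, htr₁, -, -⟩ := exists_horocycleIndex_edges_of_neg L v w hw eA heA ha A hA0 hA1 hσ hvσ hϖ hσϖ hres h2 hnorm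
  have htrN₁' : ∀ d, tr₁ d ∈ t.N := fun d => by have h := htrN₁ d; subst ht; exact h
  -- the reflected edge and the `τM`-translates of apartment edges
  have hE1 : (a W).mapEdgeSet ⟨s(A 0, A (0 + 1)), (SimpleGraph.mem_edgeSet _).2 (latticeGraph_adj_apartmentEnum_succ_of_involution hσ hvσ hϖ A hA0 hA1 0)⟩ = ⟨s(A 1, A (1 + 1)), (SimpleGraph.mem_edgeSet _).2 (latticeGraph_adj_apartmentEnum_succ_of_involution hσ hvσ hϖ A hA0 hA1 1)⟩ :=
    mapEdgeSet_tau_weylLong_apartmentEnum_zero_of_involution L v w hw eA ha A hA0 hA1 τM hτA hσ hvσ hϖ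
  have hzpow : ∀ c j : ℤ, (a (τM ^ c)).mapEdgeSet ⟨s(A (j), A (j + 1)), (SimpleGraph.mem_edgeSet _).2 (latticeGraph_adj_apartmentEnum_succ_of_involution hσ hvσ hϖ A hA0 hA1 (j))⟩ = ⟨s(A (j + 2 * c), A (j + 2 * c + 1)), (SimpleGraph.mem_edgeSet _).2 (latticeGraph_adj_apartmentEnum_succ_of_involution hσ hvσ hϖ A hA0 hA1 (j + 2 * c))⟩ := fun c j => by
    apply Subtype.ext
    change Sym2.map (a (τM ^ c)) s(A j, A (j + 1)) = s(A (j + 2 * c), A (j + 2 * c + 1))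
    rw [Sym2.map_mk, actionHom_zpow_apartmentEnum L v w hw eA ha A τM hτA, actionHom_zpow_apartmentEnum L v w hw eA ha A τM hτA,
      show j + 1 + 2 * c = j + 2 * c + 1 by ring]
  -- an apartment edge is determined by its index (transport of the anonymous constructor along an index equation)
  have hEeq : ∀ {j j' : ℤ}, j = j' → (⟨s(A (j), A (j + 1)), (SimpleGraph.mem_edgeSet _).2 (latticeGraph_adj_apartmentEnum_succ_of_involution hσ hvσ hϖ A hA0 hA1 (j))⟩ : (latticeGraph (galAdicCompletionMap (L := L) (IsCMField.complexConj L) hw) ϖ ((StdForm.antidiagonal 3).over (w.1.adicCompletion L))).edgeSet) = ⟨s(A (j'), A (j' + 1)), (SimpleGraph.mem_edgeSet _).2 (latticeGraph_adj_apartmentEnum_succ_of_involution hσ hvσ hϖ A hA0 hA1 (j'))⟩ := by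
    rintro j j' rfl; rfl
  -- conjugated membership in `P₁` = fixing the translated base edge
  have hconj : ∀ g u : Gqs L v, g⁻¹ * u * g ∈ P₁ ↔ (a u).mapEdgeSet ((a g).mapEdgeSet ⟨s(A 0, A (0 + 1)), (SimpleGraph.mem_edgeSet _).2 (latticeGraph_adj_apartmentEnum_succ_of_involution hσ hvσ hϖ A hA0 hA1 0)⟩) = (a g).mapEdgeSet ⟨s(A 0, A (0 + 1)), (SimpleGraph.mem_edgeSet _).2 (latticeGraph_adj_apartmentEnum_succ_of_involution hσ hvσ hϖ A hA0 hA1 0)⟩ := by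
    intro g u
    rw [hP₁]
    constructor
    · intro h
      have h' := congrArg ((a g).mapEdgeSet) h
      rwa [← mapEdgeSet_actionHom_mul L v w hw eA ha, show g * (g⁻¹ * u * g) = u * g by group, mapEdgeSet_actionHom_mul L v w hw eA ha] at h'
    · intro h
      rw [mapEdgeSet_actionHom_mul L v w hw eA ha, mapEdgeSet_actionHom_mul L v w hw eA ha, h]
      exact mapEdgeSet_actionHom_inv_eq L v w hw eA ha rfl
  refine ⟨fun y => ?_, fun i j hij => ?_, fun i y => ?_, fun i x => ?_, fun i => ?_⟩
  · -- hcover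
    set d := (a y).mapEdgeSet ⟨s(A 0, A (0 + 1)), (SimpleGraph.mem_edgeSet _).2 (latticeGraph_adj_apartmentEnum_succ_of_involution hσ hvσ hϖ A hA0 hA1 0)⟩ with hdd
    obtain ⟨c, hc | hc⟩ := Int.even_or_odd' (idx₁ d)
    · have hh : (a (tr₁ d * τM ^ c)).mapEdgeSet ⟨s(A 0, A (0 + 1)), (SimpleGraph.mem_edgeSet _).2 (latticeGraph_adj_apartmentEnum_succ_of_involution hσ hvσ hϖ A hA0 hA1 0)⟩ = d := by
        rw [mapEdgeSet_actionHom_mul L v w hw eA ha, hzpow c 0, hEeq (show (0 : ℤ) + 2 * c = idx₁ d by rw [hc, zero_add])]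
        exact htr₁ d
      refine ⟨0, ⟨tr₁ d * τM ^ c, mul_mem (t.N_le (htrN₁' d)) (t.M_le (zpow_mem hτM c))⟩, (tr₁ d * τM ^ c)⁻¹ * y, ?_, ?_⟩
      · rw [hP₁, mapEdgeSet_actionHom_mul L v w hw eA ha]
        exact mapEdgeSet_actionHom_inv_eq L v w hw eA ha hh
      · change y = (tr₁ d * τM ^ c) * (![(1 : Gqs L v), W] 0) * ((tr₁ d * τM ^ c)⁻¹ * y)
        simp only [Matrix.cons_val_zero, mul_one, mul_inv_cancel_left]
    · have hh : (a (tr₁ d * τM ^ c * W)).mapEdgeSet ⟨s(A 0, A (0 + 1)), (SimpleGraph.mem_edgeSet _).2 (latticeGraph_adj_apartmentEnum_succ_of_involution hσ hvσ hϖ A hA0 hA1 0)⟩ = d := by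
        rw [mapEdgeSet_actionHom_mul L v w hw eA ha, mapEdgeSet_actionHom_mul L v w hw eA ha, hE1, hzpow c 1,
          hEeq (show (1 : ℤ) + 2 * c = idx₁ d by rw [hc]; ring)]
        exact htr₁ d
      refine ⟨1, ⟨tr₁ d * τM ^ c, mul_mem (t.N_le (htrN₁' d)) (t.M_le (zpow_mem hτM c))⟩, (tr₁ d * τM ^ c * W)⁻¹ * y, ?_, ?_⟩
      · rw [hP₁, mapEdgeSet_actionHom_mul L v w hw eA ha]
        exact mapEdgeSet_actionHom_inv_eq L v w hw eA ha hh
      · change y = (tr₁ d * τM ^ c) * (![(1 : Gqs L v), W] 1) * ((tr₁ d * τM ^ c * W)⁻¹ * y)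
        simp only [Matrix.cons_val_one, Matrix.cons_val_zero, mul_inv_cancel_left]
  · -- hdisj
    fin_cases i <;> fin_cases j
    · rfl
    · exfalso
      obtain ⟨h, κ, hκ, hEq⟩ := hij
      simp only [Fin.zero_eta, Fin.mk_one, Matrix.cons_val_zero, Matrix.cons_val_one, mul_one] at hEq
      refine mapEdgeSet_apartmentEnum_zero_ne_one_of_mem_P_of_neg L v w hw eA heA ha A hA0 hA1 t ht hσ hvσ hϖ hσϖ hres h2 hnorm h.2 ?_
      rw [← hE1, hEq, mapEdgeSet_actionHom_mul L v w hw eA ha, (hP₁ κ).1 hκ]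
    · exfalso
      obtain ⟨h, κ, hκ, hEq⟩ := hij
      simp only [Fin.zero_eta, Fin.mk_one, Matrix.cons_val_zero, Matrix.cons_val_one] at hEq
      have hW' : W = (h : Gqs L v)⁻¹ * κ⁻¹ := by
        rw [show (h : Gqs L v)⁻¹ * κ⁻¹ = (h : Gqs L v)⁻¹ * ((h : Gqs L v) * W * κ) * κ⁻¹ by rw [← hEq, mul_one]]
        group
      refine mapEdgeSet_apartmentEnum_zero_ne_one_of_mem_P_of_neg L v w hw eA heA ha A hA0 hA1 t ht hσ hvσ hϖ hσϖ hres h2 hnorm (inv_mem h.2) ?_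
      rw [← hE1, hW', mapEdgeSet_actionHom_mul L v w hw eA ha, (hP₁ κ⁻¹).1 (inv_mem hκ)]
    · rfl
  · -- hT
    rw [Subgroup.mem_inf, Subgroup.mem_map_equiv, MulAut.conj_symm_apply]
  · -- hdec
    have hxP : (x : Gqs L v) ∈ t.P := (Subgroup.mem_inf.1 x.2).1
    have hxK := (Subgroup.mem_inf.1 x.2).2
    rw [Subgroup.mem_map_equiv, MulAut.conj_symm_apply, hconj] at hxK
    -- the translated base edge is an apartment edge `{A m, A (m+1)}`, `m = i`
    obtain ⟨m, hm⟩ : ∃ m : ℤ, (a (![(1 : Gqs L v), W] i)).mapEdgeSet ⟨s(A 0, A (0 + 1)), (SimpleGraph.mem_edgeSet _).2 (latticeGraph_adj_apartmentEnum_succ_of_involution hσ hvσ hϖ A hA0 hA1 0)⟩ = ⟨s(A (m), A (m + 1)), (SimpleGraph.mem_edgeSet _).2 (latticeGraph_adj_apartmentEnum_succ_of_involution hσ hvσ hϖ A hA0 hA1 (m))⟩ := by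
      fin_cases i
      · exact ⟨0, by simp only [Fin.zero_eta, Matrix.cons_val_zero]; exact mapEdgeSet_actionHom_one L v w hw eA ha _⟩
      · exact ⟨1, by simp only [Fin.mk_one, Matrix.cons_val_one]; exact hE1⟩
    rw [hm] at hxK
    obtain ⟨c, n, hcM, hcA, hnN, hnE, hx⟩ := exists_torus_mul_unipotent_of_mem_P_of_mapEdgeSet_eq_of_neg L v w hw eA heA ha A hA0 hA1 t ht hσ hvσ hϖ hσϖ hres h2 hnorm hxP hxK
    have hcE : (a c).mapEdgeSet ((a (![(1 : Gqs L v), W] i)).mapEdgeSet ⟨s(A 0, A (0 + 1)), (SimpleGraph.mem_edgeSet _).2 (latticeGraph_adj_apartmentEnum_succ_of_involution hσ hvσ hϖ A hA0 hA1 0)⟩) = (a (![(1 : Gqs L v), W] i)).mapEdgeSet ⟨s(A 0, A (0 + 1)), (SimpleGraph.mem_edgeSet _).2 (latticeGraph_adj_apartmentEnum_succ_of_involution hσ hvσ hϖ A hA0 hA1 0)⟩ := by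
      rw [hm]; exact mapEdgeSet_apartmentEnum_eq_self_of_forall_apply_eq_of_involution L v w hw A hA0 hA1 hσ hvσ hϖ hcA m
    have hnE' : (a n).mapEdgeSet ((a (![(1 : Gqs L v), W] i)).mapEdgeSet ⟨s(A 0, A (0 + 1)), (SimpleGraph.mem_edgeSet _).2 (latticeGraph_adj_apartmentEnum_succ_of_involution hσ hvσ hϖ A hA0 hA1 0)⟩) = (a (![(1 : Gqs L v), W] i)).mapEdgeSet ⟨s(A 0, A (0 + 1)), (SimpleGraph.mem_edgeSet _).2 (latticeGraph_adj_apartmentEnum_succ_of_involution hσ hvσ hϖ A hA0 hA1 0)⟩ := by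
      rw [hm]; exact hnE
    refine ⟨⟨c, Subgroup.mem_inf.2 ⟨t.M_le hcM, ?_⟩⟩, Subgroup.mem_subgroupOf.2 (Subgroup.mem_inf.2 ⟨hcM, (hP₀ c).2 (hcA 0)⟩),
      ⟨n, Subgroup.mem_inf.2 ⟨t.N_le hnN, ?_⟩⟩, Subgroup.mem_subgroupOf.2 hnN, Subtype.ext hx⟩
    · rw [Subgroup.mem_map_equiv, MulAut.conj_symm_apply, hconj]; exact hcE
    · rw [Subgroup.mem_map_equiv, MulAut.conj_symm_apply, hconj]; exact hnE'
  · -- hC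
    obtain ⟨m, hm⟩ : ∃ m : ℤ, (a (![(1 : Gqs L v), W] i)).mapEdgeSet ⟨s(A 0, A (0 + 1)), (SimpleGraph.mem_edgeSet _).2 (latticeGraph_adj_apartmentEnum_succ_of_involution hσ hvσ hϖ A hA0 hA1 0)⟩ = ⟨s(A (m), A (m + 1)), (SimpleGraph.mem_edgeSet _).2 (latticeGraph_adj_apartmentEnum_succ_of_involution hσ hvσ hϖ A hA0 hA1 (m))⟩ := by
      fin_cases i
      · exact ⟨0, by simp only [Fin.zero_eta, Matrix.cons_val_zero]; exact mapEdgeSet_actionHom_one L v w hw eA ha _⟩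
      · exact ⟨1, by simp only [Fin.mk_one, Matrix.cons_val_one]; exact hE1⟩
    refine isCompact_subgroupOf_M_inf L v w hw eA heA ha t ht P₀ (A 0) hP₀ _ fun c hc => Subgroup.mem_inf.2 ⟨t.M_le (Subgroup.mem_inf.1 hc).1, ?_⟩
    have hcM : c ∈ (cmBorelTriple L 3 v : ParabolicTriple (Gqs L v)).M := by have h := (Subgroup.mem_inf.1 hc).1; subst ht; exact h
    have hcA : ∀ k : ℤ, a c (A k) = A k :=
      apartmentEnum_eq_self_of_mem_cmBorelTriple_M_of_apply_zero_of_involution L v w hw eA heA ha A hA0 hA1 hσ hvσ hϖ hcM ((hP₀ c).1 (Subgroup.mem_inf.1 hc).2)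
    rw [Subgroup.mem_map_equiv, MulAut.conj_symm_apply, hconj, hm]
    exact mapEdgeSet_apartmentEnum_eq_self_of_forall_apply_eq_of_involution L v w hw A hA0 hA1 hσ hvσ hϖ hcA m

/-! ### ED. 2 (append-only behind p853593): the three DOCKING one-liners `hCM ∕ hCT ∕ hr` of the generic consumer (61-G `…_block_eigen_oneChains`) at the Iwahori package, ANY isometric involution (twin of ★ B-3b ED. 2 `borelDoubleCoset_edge_dock`) -/

include heA ha hA0 hA1 ht hτA in
set_option maxHeartbeats 1600000 in  -- the datum edge type (statement `whnf` + `fin_cases` on the CM carriers)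
/-- **DOCKING ONE-LINERS FOR THE IWAHORI PACKAGE, ANY ISOMETRIC INVOLUTION** (twin of ★ B-3b ED. 2 `borelDoubleCoset_edge_dock`: `hd` sat only in the edge certificates and in three
★ B-1∕B-3b callees with `_of_involution` siblings — ★ FILE 1-RAM `apartmentEnum_eq_self_of_mem_cmBorelTriple_M_of_apply_zero_of_involution`, (4′), (3′) above; letters `(hσ hvσ hϖ)` as the
head's first own binders; conclusion VERBATIM up to ★ B1's certificates) — in the shapes of the generic consumer (61-G `…_block_eigen_oneChains`: `(C : Subgroup Γ) (hCM : C ≤ t.M)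
(hCT : ∀ i, C ≤ T i)` and `(hr : ∀ i, (a (g i)).mapEdgeSet b₀ ∈ R₁)`), at `C := t.M ⊓ P₀`, `g := ![1, τM w₀]`, `T i := t.P ⊓ P₁.map (MulAut.conj (g i))`, `b₀ := e₀`,
`R₁ := Set.range (j ↦ {A j, A (j+1)})` (★ B-2's edge representatives): `T ∩ Stab(A 0) ≤ T`; `T ∩ Stab(A 0) ≤ B ∩ Stab(g i · e₀)` (a torus element fixing `A 0` fixes the
apartment pointwise ★ B-1, hence `e₀` and `e₁ = (τM w₀) · e₀`); `g i · e₀ ∈ {e₀, e₁} ⊆ R₁`. [cite: BruhatTits1972, §10] [cite: Serre1980Trees, II.1.1] -/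
theorem borelDoubleCoset_edge_dock_of_involution
    (hσ : ∀ x, (galAdicCompletionMap (L := L) (IsCMField.complexConj L) hw) ((galAdicCompletionMap (L := L) (IsCMField.complexConj L) hw) x) = x)
    (hvσ : ∀ x, Valued.v ((galAdicCompletionMap (L := L) (IsCMField.complexConj L) hw) x) = Valued.v x) (hϖ : Valued.v ϖ = WithZero.exp (-1 : ℤ))
    (P₀ P₁ : Subgroup (Gqs L v)) (hP₀ : ∀ g, g ∈ P₀ ↔ a g (A 0) = A 0)
    (hP₁ : ∀ g, g ∈ P₁ ↔ (a g).mapEdgeSet ⟨s(A 0, A (0 + 1)), (SimpleGraph.mem_edgeSet _).2 (latticeGraph_adj_apartmentEnum_succ_of_involution hσ hvσ hϖ A hA0 hA1 0)⟩ =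
      ⟨s(A 0, A (0 + 1)), (SimpleGraph.mem_edgeSet _).2 (latticeGraph_adj_apartmentEnum_succ_of_involution hσ hvσ hϖ A hA0 hA1 0)⟩) :
    ((t.M ⊓ P₀ : Subgroup (Gqs L v)) ≤ t.M) ∧
    (∀ i : Fin 2, (t.M ⊓ P₀ : Subgroup (Gqs L v)) ≤ t.P ⊓ P₁.map (MulAut.conj (![(1 : Gqs L v), τM * eA.symm (weylLongU (galAdicCompletionMap (L := L) (IsCMField.complexConj L) hw) rfl)] i)).toMonoidHom) ∧
    (∀ i : Fin 2, (a (![(1 : Gqs L v), τM * eA.symm (weylLongU (galAdicCompletionMap (L := L) (IsCMField.complexConj L) hw) rfl)] i)).mapEdgeSet ⟨s(A 0, A (0 + 1)), (SimpleGraph.mem_edgeSet _).2 (latticeGraph_adj_apartmentEnum_succ_of_involution hσ hvσ hϖ A hA0 hA1 0)⟩ ∈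
      (Set.range fun j : ℤ => (⟨s(A j, A (j + 1)), (SimpleGraph.mem_edgeSet _).2 (latticeGraph_adj_apartmentEnum_succ_of_involution hσ hvσ hϖ A hA0 hA1 j)⟩ : (latticeGraph (galAdicCompletionMap (L := L) (IsCMField.complexConj L) hw) ϖ ((StdForm.antidiagonal 3).over (w.1.adicCompletion L))).edgeSet))) := by
  have hE1 := mapEdgeSet_tau_weylLong_apartmentEnum_zero_of_involution L v w hw eA ha A hA0 hA1 τM hτA hσ hvσ hϖ
  have hm : ∀ i : Fin 2, ∃ m : ℤ, (a (![(1 : Gqs L v), τM * eA.symm (weylLongU (galAdicCompletionMap (L := L) (IsCMField.complexConj L) hw) rfl)] i)).mapEdgeSet ⟨s(A 0, A (0 + 1)), (SimpleGraph.mem_edgeSet _).2 (latticeGraph_adj_apartmentEnum_succ_of_involution hσ hvσ hϖ A hA0 hA1 0)⟩ = ⟨s(A m, A (m + 1)), (SimpleGraph.mem_edgeSet _).2 (latticeGraph_adj_apartmentEnum_succ_of_involution hσ hvσ hϖ A hA0 hA1 m)⟩ := by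
    intro i
    fin_cases i
    · exact ⟨0, by simp only [Fin.zero_eta, Matrix.cons_val_zero]; exact mapEdgeSet_actionHom_one L v w hw eA ha _⟩
    · exact ⟨1, by simp only [Fin.mk_one, Matrix.cons_val_one]; exact hE1⟩
  refine ⟨inf_le_left, fun i c hc => Subgroup.mem_inf.2 ⟨t.M_le (Subgroup.mem_inf.1 hc).1, ?_⟩, fun i => ?_⟩
  · obtain ⟨m, hm⟩ := hm i
    have hcM : c ∈ (cmBorelTriple L 3 v : ParabolicTriple (Gqs L v)).M := by have h := (Subgroup.mem_inf.1 hc).1; subst ht; exact h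
    have hcA : ∀ k : ℤ, a c (A k) = A k :=
      apartmentEnum_eq_self_of_mem_cmBorelTriple_M_of_apply_zero_of_involution L v w hw eA heA ha A hA0 hA1 hσ hvσ hϖ hcM ((hP₀ c).1 (Subgroup.mem_inf.1 hc).2)
    rw [Subgroup.mem_map_equiv, MulAut.conj_symm_apply, hP₁, mapEdgeSet_actionHom_mul L v w hw eA ha, mapEdgeSet_actionHom_mul L v w hw eA ha, hm,
      mapEdgeSet_apartmentEnum_eq_self_of_forall_apply_eq_of_involution L v w hw A hA0 hA1 hσ hvσ hϖ hcA m]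
    exact mapEdgeSet_actionHom_inv_eq L v w hw eA ha hm
  · obtain ⟨m, hm⟩ := hm i
    exact ⟨m, hm.symm⟩

end Iwahori

end Summit.HodgeConjecture.HodgeConjecture.Cruxes.H413.F0P3cStCharTSHorocyclesAtDatumRamified

end
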